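import Summits.CriticalPhenomena.Ising3DConformalLimit.Theorems.PerfectScreeningSubharmonicOffOriginPskDefs
import Literature.Probability.LatticeModels.LatticeGreenPoisson
import Literature.Probability.LatticeModels.LatticeDirichletEnergy
import HarnessLib

/-!
# Crux `PerfectScreening.SubharmonicOffOrigin` (stmt-CriticalPhenomena-1341), line `SketchIdeator1`:
# stub `stub_massiveGreen_poisson` (the massive Poisson identity on `ℤ³`)

This file proves the registered stub `stub_massiveGreen_poisson` of the lead's checked skeleton of line
`SketchIdeator1` (planar-source Källén–Lehmann mixture): for every mass `s ≥ 0` and every `x ∈ ℤ³` the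
massive lattice Green function `G_s = massiveGreen s` of
`Theorems/PerfectScreeningSubharmonicOffOriginPskDefs.lean`,
`G_s(x) = ∫_{[-π,π]^d} cos (p·x) / (s + 2ε(p)) dp/(2π)^d`, satisfies the seven-point-stencil identity

  `(6 + s) G_s(x) − Σᵢ (G_s(x + eᵢ) + G_s(x − eᵢ)) = [x = 0]`,

i.e. `(s − Δ) G_s = δ₀` for the graph Laplacian `Δ = latticeLaplacianZd` of `ℤ³`.

## Proof

* `s > 0` (every dimension `d`, `massiveGreen_poisson_of_pos`): the integrand
  `p ↦ cos (p·z) / (s + 2ε(p))` is continuous (the denominator is `≥ s > 0`), hence integrable on the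
  compact Brillouin zone; by linearity of the Bochner integral the left side is
  `(2π)^{-d} ∫ [(2d + s) cos (p·x) − Σᵢ (cos (p·(x+eᵢ)) + cos (p·(x−eᵢ)))] / (s + 2ε(p)) dp`, and the
  Fourier symbol of the Laplacian (`latticeLaplacianZd_cos_sum_mul`:
  `Σᵢ (cos (p·(x+eᵢ)) + cos (p·(x−eᵢ))) − 2d cos (p·x) = −2ε(p) cos (p·x)`) makes the bracket
  `(s + 2ε(p)) cos (p·x)`, so the integrand is `cos (p·x)` and orthogonality
  (`integral_brillouin_cos_sum_mul`: `∫ cos (p·x) dp = (2π)^d [x = 0]`) finishes.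
* `s = 0` (`d ≥ 3`, `massiveGreen_zero_poisson`): `massiveGreen 0 = latticeGreen / 2`
  (`massiveGreen_zero`) and the tree's Poisson identity `Δ (latticeGreen / 2) = −δ₀`
  (`latticeLaplacianZd_half_latticeGreen`).

References: G. F. Lawler, *Intersections of Random Walks* (1991), §1.5; G. F. Lawler, V. Limic,
*Random Walk: A Modern Introduction* (2010), §4.2–4.3 (Green functions with killing).
-/

noncomputable section

open MeasureTheory Finset Real
open Literature.Probability.LatticeModels

namespace Summit.CriticalPhenomena.Ising3DConformalLimit.Theorems.PerfectScreening.Psk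

variable {d : ℕ}

/-- For `s > 0` the massive Green integrand `p ↦ cos (p·z) / (s + 2ε(p))` is continuous on momentum
space (its denominator is `≥ s > 0` since `ε ≥ 0`). -/
theorem continuous_massiveGreenIntegrand {s : ℝ} (hs : 0 < s) (z : Site d) :
    Continuous fun p : Fin d → ℝ => Real.cos (∑ j, p j * (z j : ℝ)) / (s + 2 * dispersion p) := by
  have hden : ∀ p : Fin d → ℝ, s + 2 * dispersion p ≠ 0 := fun p => by
    have := dispersion_nonneg p; positivity
  have h1 : Continuous fun p : Fin d → ℝ => Real.cos (∑ j, p j * (z j : ℝ)) := by fun_prop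
  have h2 : Continuous fun p : Fin d → ℝ => s + 2 * dispersion p := by
    have := continuous_dispersion d; fun_prop
  exact h1.div h2 hden

/-- **The massive Poisson identity, `s > 0`** (every dimension `d`): the massive lattice Green function
`G_s = massiveGreen s` satisfies `(2d + s) G_s(x) − Σᵢ (G_s(x + eᵢ) + G_s(x − eᵢ)) = [x = 0]`, i.e.
`(s − Δ) G_s = δ₀` on `ℤ^d`.  Fourier symbol of the Laplacian against the (continuous, hence integrable)
integrand `cos (p·z) / (s + 2ε(p))`, then orthogonality of characters. -/
theorem massiveGreen_poisson_of_pos {s : ℝ} (hs : 0 < s) (x : Site d) :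
    (2 * d + s) * massiveGreen s x
        - ∑ i : Fin d, (massiveGreen s (x + Pi.single i 1) + massiveGreen s (x - Pi.single i 1))
      = if x = 0 then 1 else 0 := by
  -- the integrand `F z p = cos (p·z) / (s + 2ε(p))` and its integrability on the Brillouin zone
  set F : Site d → (Fin d → ℝ) → ℝ := fun z p =>
    Real.cos (∑ j, p j * (z j : ℝ)) / (s + 2 * dispersion p) with hF
  have hI : ∀ z : Site d, Integrable (F z) ((volume : Measure (Fin d → ℝ)).restrict (brillouin d)) :=
    fun z => integrableOn_brillouin_of_continuous (continuous_massiveGreenIntegrand hs z)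
  have hmg : ∀ z : Site d, massiveGreen s z = (∫ p in brillouin d, F z p) / (2 * π) ^ d :=
    fun z => rfl
  -- Step 1: pull the (finite) linear combination out of the integrals
  have step1 : (2 * d + s) * massiveGreen s x
      - ∑ i : Fin d, (massiveGreen s (x + Pi.single i 1) + massiveGreen s (x - Pi.single i 1)) =
      ((2 * d + s) * (∫ p in brillouin d, F x p) -
        ∑ i, ((∫ p in brillouin d, F (x + Pi.single i 1) p) +
          ∫ p in brillouin d, F (x - Pi.single i 1) p)) / (2 * π) ^ d := by
    simp only [hmg, sub_div, Finset.sum_div, add_div]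
    ring
  have hF2 : ∀ i ∈ (univ : Finset (Fin d)), Integrable
      (fun p => F (x + Pi.single i 1) p + F (x - Pi.single i 1) p)
      ((volume : Measure (Fin d → ℝ)).restrict (brillouin d)) := fun i _ => (hI _).add (hI _)
  have hsumI : Integrable (fun p => ∑ i, (F (x + Pi.single i 1) p + F (x - Pi.single i 1) p))
      ((volume : Measure (Fin d → ℝ)).restrict (brillouin d)) := integrable_finsetSum univ hF2
  have hcI : Integrable (fun p => (2 * d + s) * F x p)
      ((volume : Measure (Fin d → ℝ)).restrict (brillouin d)) := (hI x).const_mul _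
  have step2 : ∫ p in brillouin d, ((2 * d + s) * F x p -
        ∑ i, (F (x + Pi.single i 1) p + F (x - Pi.single i 1) p)) =
      (2 * d + s) * (∫ p in brillouin d, F x p) -
        ∑ i, ((∫ p in brillouin d, F (x + Pi.single i 1) p) +
          ∫ p in brillouin d, F (x - Pi.single i 1) p) := by
    rw [integral_sub hcI hsumI, integral_finsetSum univ hF2, integral_const_mul]
    congr 1
    exact Finset.sum_congr rfl fun i _ => integral_add (hI _) (hI _)
  -- Step 2: the integrand is `cos (p·x)` (Fourier symbol `-2ε(p)` of the Laplacian)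
  have hpt : ∀ p : Fin d → ℝ, (2 * d + s) * F x p -
        ∑ i, (F (x + Pi.single i 1) p + F (x - Pi.single i 1) p) =
      Real.cos (∑ j, p j * (x j : ℝ)) := by
    intro p
    have hD : s + 2 * dispersion p ≠ 0 := by have := dispersion_nonneg p; positivity
    have key := latticeLaplacianZd_cos_sum_mul p x
    simp only [latticeLaplacianZd] at key
    have hS : ∑ i, (Real.cos (∑ j, p j * ((x + Pi.single i 1 : Site d) j : ℝ)) +
        Real.cos (∑ j, p j * ((x - Pi.single i 1 : Site d) j : ℝ))) =
        (2 * d - 2 * dispersion p) * Real.cos (∑ j, p j * (x j : ℝ)) := by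
      linear_combination key
    simp only [hF]
    simp_rw [← add_div, ← Finset.sum_div]
    rw [hS]
    field_simp
    ring
  have hae : (fun p : Fin d → ℝ => (2 * d + s) * F x p -
        ∑ i, (F (x + Pi.single i 1) p + F (x - Pi.single i 1) p)) =
      fun p => Real.cos (∑ j, p j * (x j : ℝ)) := funext hpt
  -- Step 3: orthogonality
  rw [step1, ← step2, hae, integral_brillouin_cos_sum_mul]
  have hπ : (2 * π) ^ d ≠ 0 := by positivity
  split_ifs
  · exact div_self hπ
  · exact zero_div _

/-- **The massive Poisson identity at `s = 0`** (`d ≥ 3`): `2d G₀(x) − Σᵢ (G₀(x + eᵢ) + G₀(x − eᵢ)) = [x = 0]`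
for `G₀ = massiveGreen 0 = latticeGreen / 2`, the tree's `(-Δ) (latticeGreen / 2) = δ₀`
(`latticeLaplacianZd_half_latticeGreen`). -/
theorem massiveGreen_zero_poisson (hd : 3 ≤ d) (x : Site d) :
    (2 * d + 0) * massiveGreen 0 x
        - ∑ i : Fin d, (massiveGreen 0 (x + Pi.single i 1) + massiveGreen 0 (x - Pi.single i 1))
      = if x = 0 then 1 else 0 := by
  have key := latticeLaplacianZd_half_latticeGreen d hd x
  simp only [latticeLaplacianZd, ← massiveGreen_zero] at key
  linear_combination (-1 : ℝ) * key

/-- **The massive Poisson identity** (`d ≥ 3`, `s ≥ 0`):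
`(2d + s) G_s(x) − Σᵢ (G_s(x + eᵢ) + G_s(x − eᵢ)) = [x = 0]`, i.e. `(s − Δ) G_s = δ₀` on `ℤ^d`. -/
theorem massiveGreen_poisson (hd : 3 ≤ d) {s : ℝ} (hs : 0 ≤ s) (x : Site d) :
    (2 * d + s) * massiveGreen s x
        - ∑ i : Fin d, (massiveGreen s (x + Pi.single i 1) + massiveGreen s (x - Pi.single i 1))
      = if x = 0 then 1 else 0 := by
  rcases hs.eq_or_lt with h | hs'
  · subst h
    exact massiveGreen_zero_poisson hd x
  · exact massiveGreen_poisson_of_pos hs' x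

/-- Stub `stub_massiveGreen_poisson` of line `SketchIdeator1` (support): the massive Poisson identity
`(s − Δ) G_s = δ₀` on `ℤ³`, `s ≥ 0`, in seven-point-stencil form
`(6 + s) G_s(x) − Σᵢ (G_s(x + eᵢ) + G_s(x − eᵢ)) = [x = 0]`. -/
theorem stub_massiveGreen_poisson : ∀ s : ℝ, 0 ≤ s → ∀ x : Site 3, (6 + s) * massiveGreen s x - ∑ i : Fin 3, (massiveGreen s (x + Pi.single i 1) + massiveGreen s (x - Pi.single i 1)) = if x = 0 then 1 else 0 := by
  intro s hs x
  have h := massiveGreen_poisson (d := 3) le_rfl hs x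
  have h6 : (2 * ((3 : ℕ) : ℝ) + s) = 6 + s := by norm_num
  rw [h6] at h
  exact h

end Summit.CriticalPhenomena.Ising3DConformalLimit.Theorems.PerfectScreening.Psk

end
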